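import Literature.MathematicalPhysics.QuantumFieldTheory.Balaban1983to89.B1Eq324BenfattoSect5StepBound
import Literature.MathematicalPhysics.QuantumFieldTheory.Balaban1983to89.B1Eq324BenfattoSect5PerBoxErrBound
import Literature.MathematicalPhysics.QuantumFieldTheory.Balaban1983to89.B1Eq324BenfattoSect5CollectErrors
import Literature.MathematicalPhysics.QuantumFieldTheory.Balaban1983to89.B1Eq324BenfattoSect5LowerAssembly
import HarnessLib

/-!
# Benfatto et al. 1978, §5 — the upper bound (4.6) of the Basic Lemma from ONE closed ledger inequality

doc: Literature/MathematicalPhysics/QuantumFieldTheory/Balaban1983to89/B1Eq324BenfattoLemma.md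

This module is the (4.6) twin of `…Sect5LowerAssembly`: it ASSEMBLES the UPPER pavement chain under a far conditioning set `C`
(`d(Δ_x, Δ_y) ≥ R > √d(L−1)` for `x ∈ C`, `y ∈ J`; print `R = b³`) with conditioning values `z̄`: clip `a` to `J`, chain
`J_{k+1} = (J_k + τ_k) ∩ Γ̄₁(B_k)`, `C_{k+1} = C_k + τ_k`, `z̄_{k+1} = z̄_k(· − τ_k)`, constant diagonal shifts `τ_k ≡ −2(2w+v)𝟙`, GROWING box cut-offs
`b_k = b/γ^{k+1}` (input cut-off `γ b_k = b/γ^k`, `γ b_0 = b`), `…StepBound.exists_upper_step` at every frame-`k` datum (per-box UPPER bounds under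
`E(·|(C_k + τ_k) ∪ Γ₁(B_k))`, identification, closed cumulant-side errors), `…PavementChainUpper.ineq46_of_chain` (chain + telescoping; no Appendix A on
this side), and every cardinality by `|I|`.  Outcome `ineq46_of_ledger`: (4.6) — `Ineq46 d α β t D s κ S ρ₁ ρ₂ ρ₃ ρ₄ b I J C a z̄` — from ONE closed real
inequality `Σ_{n<d+1} RAWU_n(b, A, L, w, v, γ, δ, |I|) ≤ |I|·errTerm S ρ₁ ρ₂ ρ₃ ρ₄ A b t` (`A = coefSup`).
[cite: BenfattoEtAl1978, Basic Lemma (4.6) p.152; §5 pp.154–159, (5.36) p.159]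

## Theorems
* ★ `ineq46_of_ledger` — (4.6) from the closed ledger inequality.
-/

namespace Literature.MathematicalPhysics.QuantumFieldTheory.Balaban1983to89.B1Eq324BenfattoSect5UpperAssembly

open MeasureTheory ProbabilityTheory Finset
open scoped BigOperators Nat
open Literature.Probability.LatticeModels (setPartitions)
open Literature.MathematicalPhysics.QuantumFieldTheory
open Literature.MathematicalPhysics.QuantumFieldTheory.Balaban1983to89.B1Eq324BenfattoLemma
open Literature.MathematicalPhysics.QuantumFieldTheory.Balaban1983to89.B1Eq324BenfattoSect5Boxes
open Literature.MathematicalPhysics.QuantumFieldTheory.Balaban1983to89.B1Eq324BenfattoSect5Eq511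
open Literature.MathematicalPhysics.QuantumFieldTheory.Balaban1983to89.B1Eq324BenfattoSect5Eq524
open Literature.MathematicalPhysics.QuantumFieldTheory.Balaban1983to89.B1Eq324BenfattoSect5Eq534
open Literature.MathematicalPhysics.QuantumFieldTheory.Balaban1983to89.B1Eq324BenfattoSect5Eq515
open Literature.MathematicalPhysics.QuantumFieldTheory.Balaban1983to89.B1Eq324BenfattoSect5PavementStep
open Literature.MathematicalPhysics.QuantumFieldTheory.Balaban1983to89.B1Eq324BenfattoSect5PavementChain
open Literature.MathematicalPhysics.QuantumFieldTheory.Balaban1983to89.B1Eq324BenfattoSect5CollectErrors (card_chain_le card_boxes_le)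
open Literature.MathematicalPhysics.QuantumFieldTheory.Balaban1983to89.B1Eq324BenfattoSect5PavementChainUpper (ineq46_of_chain far_frame)
open Literature.MathematicalPhysics.QuantumFieldTheory.Balaban1983to89.B1Eq324BenfattoSect5StepBound (exists_upper_step)
open Literature.MathematicalPhysics.QuantumFieldTheory.Balaban1983to89.B1Eq324BenfattoSect5LowerAssembly (sum_le_card_mul cumb_le)
open Literature.MathematicalPhysics.QuantumFieldTheory.Balaban1983to89.B1Eq324BenfattoSect5PerBoxErrBound
open Literature.MathematicalPhysics.QuantumFieldTheory.Balaban1983to89.B1Eq324BenfattoSect5IdErrBounds (latticeSumConst_nonneg)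
open Literature.MathematicalPhysics.QuantumFieldTheory.Balaban1983to89.B1Eq324BenfattoSect5ErrTermLedger (s1Const_nonneg)
open Literature.MathematicalPhysics.QuantumFieldTheory.Balaban1983to89.B1Eq324GaussianMomentLeaf (momentConst)
open Literature.MathematicalPhysics.QuantumFieldTheory.Balaban1983to89.B1Eq324BenfattoSpecialisation (coefSup_nonneg)
open Literature.MathematicalPhysics.QuantumFieldTheory.Balaban1983to89.B1Eq324BenfattoSect5Iteration

variable {d : ℕ}

section Assembly

variable {α β : ℝ} {s D : ℕ} {κ : ℝ}

set_option maxHeartbeats 800000 in -- the closed ledger hypothesis is a very large term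
/-- ★ **(4.6) FROM THE CLOSED LEDGER.**  For `J ⊆ I`, a conditioning set `C` with `d(Δ_x,Δ_y) ≥ R > √d(L−1)` (`x ∈ C`, `y ∈ J`) and values `z̄`,
pavement parameters `L, w, v` (`2(2w+v) < L`, `(d+1)·2(2w+v) ≤ L`, `v ≤ w`, `1 ≤ w`), contraction `γ ∈ (0,1]` with `γ(1+2d/α²) ≤ ½`, cut-off `b ≥ 1` with
`L^d e^{−b²/4} ≤ 1/6`, rate `δ`: if the CLOSED per-step errors — structural `S₁A(γb_n)^D e^{−ϰw/4}|I| + S₁A b_n^D(e^{−ϰw/4}|I|L^d + e^{−ϰv/4}|I|L^d)`,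
per-box `|I|·ErrPB(b_n)` and cumulant-side `CUMB(|I|,|I|,|I|L^d)` at the box cut-offs `b_n = b/γ^{n+1}`, `n ≤ d` — total at most `|I|·errTerm S ρ₁ ρ₂ ρ₃ ρ₄ A b t`
(`A = coefSup`), then (4.6) holds: `∫ χ^b_I e^{H_J} dP(·|z̄ on C) ≤ exp(Σ_{k≤t} E^T_{P̂₀}(H_J;k)/k! + |I|·errTerm)`.
[cite: BenfattoEtAl1978, Basic Lemma (4.6) p.152; §5 pp.154–159, (5.36) p.159] -/
theorem ineq46_of_ledger (hα : 0 < α) (hβ : 0 < β) (hvar : freeCov d α β 0 0 ≤ 1 / 2) (hd : 0 < d) (hκ : 0 < κ)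
    {I J : Finset (B1Eq324BenfattoLemma.Site d)} (hJI : J ⊆ I) (a : Coef d) {A : ℝ} (hAdef : A = coefSup s D a J)
    {L w v : ℕ} (hL2 : 2 * (2 * w + v) < L) (hfit : (d + 1) * (2 * (2 * w + v)) ≤ L) (hv : v ≤ w) (hw : 1 ≤ w)
    {b γ : ℝ} (hγ0 : 0 < γ) (hγ1 : γ ≤ 1) (hγc : γ * (1 + 2 * d / α ^ 2) ≤ 1 / 2) (hb1 : 1 ≤ b)
    (hsmall : ((L : ℝ) ^ d) * Real.exp (-(b ^ 2 / 4)) ≤ 1 / 6)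
    {δ : ℝ} (hδ : 0 < δ) (hδle : δ ≤ Real.log ((2 * d + α ^ 2) / (2 * d))) (hres : 0 < κ / 2 - δ / 2 * ((D : ℝ) ^ 2 * Real.sqrt d)) (t : ℕ)
    {C : Finset (B1Eq324BenfattoLemma.Site d)} (zbar : B1Eq324BenfattoLemma.Site d → ℝ) {R : ℝ}
    (hfar : ∀ x ∈ C, ∀ y ∈ J, R ≤ cubeDist x y) (hR : Real.sqrt d * ((L : ℝ) - 1) < R) {S ρ₁ ρ₂ ρ₃ ρ₄ : ℝ}
    (hledger : ∑ n ∈ Finset.range (d + 1),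
        (((s1Const s D d κ * A * (γ * (b / γ ^ (n + 1))) ^ D * Real.exp (-(κ / 4 * w)) * (I.card : ℝ)
          + s1Const s D d κ * A * (b / γ ^ (n + 1)) ^ D *
            (Real.exp (-(κ / 4 * w)) * ((I.card : ℝ) * (L : ℝ) ^ d) + Real.exp (-(κ / 4 * v)) * ((I.card : ℝ) * (L : ℝ) ^ d))) : ℝ)
          + ((I.card : ℝ) * ((let M : ℝ := A * (L : ℝ) ^ d * ∑ p ∈ Finset.Icc 1 s, ((admissible p D).card : ℝ) *
            ((2 / (1 - Real.exp (-(κ / 2 / (p : ℕ) / Real.sqrt d))) * Real.exp (κ / 2 / (p : ℕ) / Real.sqrt d)) ^ d) ^ (p - 1)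
        let Mt : ℝ := A * Real.exp (δ / 2 * ((D : ℝ) ^ 2 * d)) * (L : ℝ) ^ d * ∑ p ∈ Finset.Icc 1 s, ((admissible p D).card : ℝ) *
            ((2 / (1 - Real.exp (-((κ / 2 - δ / 2 * ((D : ℝ) ^ 2 * Real.sqrt d)) / (p : ℕ) / Real.sqrt d))) *
              Real.exp ((κ / 2 - δ / 2 * ((D : ℝ) ^ 2 * Real.sqrt d)) / (p : ℕ) / Real.sqrt d)) ^ d) ^ (p - 1)
        let K : ℝ := 4 * (s1Const s D d κ * A * (b / γ ^ (n + 1)) ^ D * (L : ℝ) ^ d)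
        let ε : ℝ := s1Const s D d κ * A * (b / γ ^ (n + 1)) ^ D * Real.exp (-(κ / 4 * v)) * (L : ℝ) ^ d
        let W : ℝ := 3 * (((L : ℝ) ^ d) * Real.exp (-((b / γ ^ (n + 1)) ^ 2 / 4)))
        let cχ : ℕ → ℝ := fun k => 2 ^ k * ((∑ π ∈ setPartitions (univ : Finset (Fin k)), ((π.card - 1)! : ℝ)) *
            ((min 1 (2 * ((L : ℝ) ^ d) * Real.exp (-((b / γ ^ (n + 1)) ^ 2 / 4)))) ^ ((2 * k : ℕ) : ℝ)⁻¹ *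
              ((1 + (1 + 2 * d / α ^ 2) * (γ * (b / γ ^ (n + 1)))) ^ D * M * momentConst D (2 * k) (freeCov d α β 0 0).toNNReal) ^ k))
        let K₀ : ℝ := max (max 1 (freeCov d α β 0 0)) ((1 + 2 * d / α ^ 2) * (γ * (b / γ ^ (n + 1))))
        let ε₃₁ : ℝ := max (β * (2 * d * (freeCov d α β 0 0 * (2 * d / (2 * d + α ^ 2)) ^ (w - v))) *
              (γ * (b / γ ^ (n + 1)) * ((L : ℝ) ^ d * (1 + Real.sqrt d * ((L : ℝ) - 1)))))
            (2 * d * freeCov d α β 0 0 * (2 * d / (2 * d + α ^ 2)) ^ (w - v) / α ^ 2)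
        let δ₂₉ : ℕ → ℝ := fun k => 2 ^ (k * D) * 2 ^ 2 ^ (k * D) * K₀ ^ (k * D) * Real.exp (-(δ / 2 * ((v : ℝ) + 1))) * Mt ^ k
        let δ₃₁ : ℕ → ℝ := fun k => M ^ k * (2 ^ (k * D) * 2 ^ 2 ^ (k * D) * ((k * D : ℕ) * K₀ ^ (k * D) * ε₃₁))
        let Err : ℝ := 2 * (2 ^ ((t + 1).choose 2) * K ^ (t + 1) / (t + 1)!) + Real.exp (2 * K) * W
            + ∑ k ∈ Finset.range t,
                (3 ^ (k + 1) * ((∑ π ∈ setPartitions (univ : Finset (Fin (k + 1))), ((π.card - 1)! : ℝ)) * (ε * K ^ k))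
                  + 3 ^ (k + 1) * (cχ (k + 1) + δ₂₉ (k + 1)) + 3 ^ (k + 1) * (cχ (k + 1) + δ₃₁ (k + 1))) / (k + 1)!
        Err) : ℝ)
          + (            ∑ k ∈ Finset.range t,
          ((2 ^ (k + 1) * (2 ^ ((k + 1) * D) * 2 ^ 2 ^ ((k + 1) * D) * (max 1 (freeCov d α β 0 0)) ^ ((k + 1) * D)) *
          ((A * Real.exp (δ / 2 * ((D : ℝ) ^ 2 * d)) *
              Real.exp (-((κ / 2 - δ / 2 * ((D : ℝ) ^ 2 * Real.sqrt d)) / 2 * w))) * (I.card : ℝ) *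
            ∑ p ∈ Finset.Icc 1 s, ((admissible p D).card : ℝ) *
              ((2 / (1 - Real.exp (-((κ / 2 - δ / 2 * ((D : ℝ) ^ 2 * Real.sqrt d)) / 2 / (p : ℕ) / Real.sqrt d))) *
                Real.exp ((κ / 2 - δ / 2 * ((D : ℝ) ^ 2 * Real.sqrt d)) / 2 / (p : ℕ) / Real.sqrt d)) ^ d) ^ (p - 1)) *
          (A * Real.exp (δ / 2 * ((D : ℝ) ^ 2 * d)) *
            ((1 : ℝ) * (2 / (1 - Real.exp (-(δ / (2 * ((k + 1 : ℕ) : ℝ)) / Real.sqrt d))) * Real.exp (δ / (2 * ((k + 1 : ℕ) : ℝ)) / Real.sqrt d)) ^ d) *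
            ∑ p ∈ Finset.Icc 1 s, ((admissible p D).card : ℝ) *
              ((2 / (1 - Real.exp (-((κ / 2 - δ / 2 * ((D : ℝ) ^ 2 * Real.sqrt d)) / (p : ℕ) / Real.sqrt d))) *
                Real.exp ((κ / 2 - δ / 2 * ((D : ℝ) ^ 2 * Real.sqrt d)) / (p : ℕ) / Real.sqrt d)) ^ d) ^ (p - 1)) ^ k
          + 2 ^ (k + 1) * (2 ^ ((k + 1) * D) * 2 ^ 2 ^ ((k + 1) * D) * (max 1 (freeCov d α β 0 0)) ^ ((k + 1) * D)) *
        ((I.card : ℝ) * (A * Real.exp (δ / 2 * ((D : ℝ) ^ 2 * d)) * Real.exp (-((κ / 2 - δ / 2 * ((D : ℝ) ^ 2 * Real.sqrt d)) / 2 * v)) *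
          (L : ℝ) ^ d * ∑ p ∈ Finset.Icc 1 s, ((admissible p D).card : ℝ) *
              ((2 / (1 - Real.exp (-((κ / 2 - δ / 2 * ((D : ℝ) ^ 2 * Real.sqrt d)) / 2 / (p : ℕ) / Real.sqrt d))) *
                Real.exp ((κ / 2 - δ / 2 * ((D : ℝ) ^ 2 * Real.sqrt d)) / 2 / (p : ℕ) / Real.sqrt d)) ^ d) ^ (p - 1))) *
        (A * Real.exp (δ / 2 * ((D : ℝ) ^ 2 * d)) *
          (2 / (1 - Real.exp (-(δ / (2 * ((k + 1 : ℕ) : ℝ)) / Real.sqrt d))) * Real.exp (δ / (2 * ((k + 1 : ℕ) : ℝ)) / Real.sqrt d)) ^ d *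
          ∑ p ∈ Finset.Icc 1 s, ((admissible p D).card : ℝ) *
              ((2 / (1 - Real.exp (-((κ / 2 - δ / 2 * ((D : ℝ) ^ 2 * Real.sqrt d)) / (p : ℕ) / Real.sqrt d))) *
                Real.exp ((κ / 2 - δ / 2 * ((D : ℝ) ^ 2 * Real.sqrt d)) / (p : ℕ) / Real.sqrt d)) ^ d) ^ (p - 1)) ^ k)
          + (2 ^ (k + 1) * (2 ^ ((k + 1) * D) * 2 ^ 2 ^ ((k + 1) * D) * (max 1 (freeCov d α β 0 0)) ^ ((k + 1) * D)) *
          (A * Real.exp (δ / 2 * ((D : ℝ) ^ 2 * d)) * Real.exp (-((κ / 2 - δ / 2 * ((D : ℝ) ^ 2 * Real.sqrt d)) / 2 * w)) *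
            ((I.card : ℝ) * (L : ℝ) ^ d) * ∑ p ∈ Finset.Icc 1 s, ((admissible p D).card : ℝ) *
              ((2 / (1 - Real.exp (-((κ / 2 - δ / 2 * ((D : ℝ) ^ 2 * Real.sqrt d)) / 2 / (p : ℕ) / Real.sqrt d))) *
                Real.exp ((κ / 2 - δ / 2 * ((D : ℝ) ^ 2 * Real.sqrt d)) / 2 / (p : ℕ) / Real.sqrt d)) ^ d) ^ (p - 1)) *
          (A * Real.exp (δ / 2 * ((D : ℝ) ^ 2 * d)) *
            (2 / (1 - Real.exp (-(δ / (2 * ((k + 1 : ℕ) : ℝ)) / Real.sqrt d))) * Real.exp (δ / (2 * ((k + 1 : ℕ) : ℝ)) / Real.sqrt d)) ^ d *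
            ∑ p ∈ Finset.Icc 1 s, ((admissible p D).card : ℝ) *
              ((2 / (1 - Real.exp (-((κ / 2 - δ / 2 * ((D : ℝ) ^ 2 * Real.sqrt d)) / (p : ℕ) / Real.sqrt d))) *
                Real.exp ((κ / 2 - δ / 2 * ((D : ℝ) ^ 2 * Real.sqrt d)) / (p : ℕ) / Real.sqrt d)) ^ d) ^ (p - 1)) ^ k
          + 2 ^ (k + 1) * (2 ^ ((k + 1) * D) * 2 ^ 2 ^ ((k + 1) * D) * (max 1 (freeCov d α β 0 0)) ^ ((k + 1) * D)) *
        ((I.card : ℝ) * (A * Real.exp (δ / 2 * ((D : ℝ) ^ 2 * d)) * Real.exp (-((κ / 2 - δ / 2 * ((D : ℝ) ^ 2 * Real.sqrt d)) / 2 * v)) *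
          (L : ℝ) ^ d * ∑ p ∈ Finset.Icc 1 s, ((admissible p D).card : ℝ) *
              ((2 / (1 - Real.exp (-((κ / 2 - δ / 2 * ((D : ℝ) ^ 2 * Real.sqrt d)) / 2 / (p : ℕ) / Real.sqrt d))) *
                Real.exp ((κ / 2 - δ / 2 * ((D : ℝ) ^ 2 * Real.sqrt d)) / 2 / (p : ℕ) / Real.sqrt d)) ^ d) ^ (p - 1))) *
        (A * Real.exp (δ / 2 * ((D : ℝ) ^ 2 * d)) *
          (2 / (1 - Real.exp (-(δ / (2 * ((k + 1 : ℕ) : ℝ)) / Real.sqrt d))) * Real.exp (δ / (2 * ((k + 1 : ℕ) : ℝ)) / Real.sqrt d)) ^ d *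
          ∑ p ∈ Finset.Icc 1 s, ((admissible p D).card : ℝ) *
              ((2 / (1 - Real.exp (-((κ / 2 - δ / 2 * ((D : ℝ) ^ 2 * Real.sqrt d)) / (p : ℕ) / Real.sqrt d))) *
                Real.exp ((κ / 2 - δ / 2 * ((D : ℝ) ^ 2 * Real.sqrt d)) / (p : ℕ) / Real.sqrt d)) ^ d) ^ (p - 1)) ^ k)
          + 2 ^ ((k + 1) * D) * 2 ^ 2 ^ ((k + 1) * D) * (max 1 (freeCov d α β 0 0)) ^ ((k + 1) * D) *
        ((I.card : ℝ) * (((k + 1 : ℕ) : ℝ) * (k : ℝ) *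
          ((A * Real.exp (δ / 2 * ((D : ℝ) ^ 2 * d)) * ((L : ℝ) ^ d * (2 / (1 - Real.exp (-(δ / (2 * ((k + 1 : ℕ) : ℝ)) / Real.sqrt d))) * Real.exp (δ / (2 * ((k + 1 : ℕ) : ℝ)) / Real.sqrt d)) ^ d) *
              ∑ p ∈ Finset.Icc 1 s, ((admissible p D).card : ℝ) *
              ((2 / (1 - Real.exp (-((κ / 2 - δ / 2 * ((D : ℝ) ^ 2 * Real.sqrt d)) / (p : ℕ) / Real.sqrt d))) *
                Real.exp ((κ / 2 - δ / 2 * ((D : ℝ) ^ 2 * Real.sqrt d)) / (p : ℕ) / Real.sqrt d)) ^ d) ^ (p - 1)) * ((A * Real.exp (δ / 2 * ((D : ℝ) ^ 2 * d)) * Real.exp (-(δ / (2 * ((k + 1 : ℕ) : ℝ)) / 2 * ((w : ℝ) + v + 1))) * ((L : ℝ) ^ d * (2 / (1 - Real.exp (-(δ / (2 * ((k + 1 : ℕ) : ℝ)) / 2 / Real.sqrt d))) * Real.exp (δ / (2 * ((k + 1 : ℕ) : ℝ)) / 2 / Real.sqrt d)) ^ d) *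
              ∑ p ∈ Finset.Icc 1 s, ((admissible p D).card : ℝ) *
              ((2 / (1 - Real.exp (-((κ / 2 - δ / 2 * ((D : ℝ) ^ 2 * Real.sqrt d)) / (p : ℕ) / Real.sqrt d))) *
                Real.exp ((κ / 2 - δ / 2 * ((D : ℝ) ^ 2 * Real.sqrt d)) / (p : ℕ) / Real.sqrt d)) ^ d) ^ (p - 1)) *
             (A * Real.exp (δ / 2 * ((D : ℝ) ^ 2 * d)) * ((L : ℝ) ^ d * (2 / (1 - Real.exp (-(δ / (2 * ((k + 1 : ℕ) : ℝ)) / Real.sqrt d))) * Real.exp (δ / (2 * ((k + 1 : ℕ) : ℝ)) / Real.sqrt d)) ^ d) *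
              ∑ p ∈ Finset.Icc 1 s, ((admissible p D).card : ℝ) *
              ((2 / (1 - Real.exp (-((κ / 2 - δ / 2 * ((D : ℝ) ^ 2 * Real.sqrt d)) / (p : ℕ) / Real.sqrt d))) *
                Real.exp ((κ / 2 - δ / 2 * ((D : ℝ) ^ 2 * Real.sqrt d)) / (p : ℕ) / Real.sqrt d)) ^ d) ^ (p - 1)) ^ (k - 1)))))
          + (I.card : ℝ) * ((3 : ℝ) ^ (k + 1) *
        (2 ^ ((k + 1) * D) * 2 ^ 2 ^ ((k + 1) * D) * (max 1 (freeCov d α β 0 0)) ^ ((k + 1) * D) *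
            Real.exp (-(δ / 2 * ((v : ℝ) + 1))) *
          (A * Real.exp (δ / 2 * ((D : ℝ) ^ 2 * d)) * (L : ℝ) ^ d * ∑ p ∈ Finset.Icc 1 s, ((admissible p D).card : ℝ) *
              ((2 / (1 - Real.exp (-((κ / 2 - δ / 2 * ((D : ℝ) ^ 2 * Real.sqrt d)) / (p : ℕ) / Real.sqrt d))) *
                Real.exp ((κ / 2 - δ / 2 * ((D : ℝ) ^ 2 * Real.sqrt d)) / (p : ℕ) / Real.sqrt d)) ^ d) ^ (p - 1)) ^ (k + 1)))) / (k + 1)! : ℝ)))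
      ≤ (I.card : ℝ) * errTerm S ρ₁ ρ₂ ρ₃ ρ₄ A b t) :
    Ineq46 d α β t D s κ S ρ₁ ρ₂ ρ₃ ρ₄ b I J C a zbar := by
  subst hAdef
  have hA0 : 0 ≤ coefSup s D a J := coefSup_nonneg s D a J
  have hL : 0 < L := by omega
  have hb0 : 0 < b := by linarith
  have hγne : γ ≠ 0 := hγ0.ne'
  have hγpow1 : ∀ k : ℕ, γ ^ k ≤ 1 := fun k => pow_le_one₀ hγ0.le hγ1
  -- clip the coefficient to `J`
  obtain ⟨a', ha'J, ha'A, -, ha'H⟩ := exists_coefSupportedIn_clip s D a J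
  -- the chain data
  set c : ℕ := 2 * (2 * w + v) with hc
  let τ : ℕ → B1Eq324BenfattoLemma.Site d := fun _ _ => -(c : ℤ)
  let Js : ℕ → Finset (B1Eq324BenfattoLemma.Site d) := fun k => Nat.rec (motive := fun _ => Finset (B1Eq324BenfattoLemma.Site d)) J
    (fun k Jk => Jk.image (fun x => x + τ k) ∩ corridorsBar L w v ((Jk.image fun x => x + τ k).image (boxIndex L))) k
  let Bs : ℕ → Finset (B1Eq324BenfattoLemma.Site d) := fun k => ((Js k).image fun x => x + τ k).image (boxIndex L)
  let as : ℕ → Coef d := fun k => Nat.rec (motive := fun _ => Coef d) a'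
    (fun k ak => restrictCoef (shiftCoef ak (-τ k)) (corridorsBar L w v (Bs k))) k
  let Is : ℕ → Finset (B1Eq324BenfattoLemma.Site d) := fun k => Nat.rec (motive := fun _ => Finset (B1Eq324BenfattoLemma.Site d)) I
    (fun k Ik => Ik.image fun x => x + τ k) k
  let Cs : ℕ → Finset (B1Eq324BenfattoLemma.Site d) := fun k => Nat.rec (motive := fun _ => Finset (B1Eq324BenfattoLemma.Site d)) C
    (fun k Ck => Ck.image fun x => x + τ k) k
  let zs : ℕ → B1Eq324BenfattoLemma.Site d → ℝ := fun k => Nat.rec (motive := fun _ => B1Eq324BenfattoLemma.Site d → ℝ) zbar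
    (fun k zk => fun y => zk (y - τ k)) k
  let bs : ℕ → ℝ := fun k => Nat.rec (motive := fun _ => ℝ) (b / γ) (fun _ bk => bk / γ) k
  have hrecJ : ∀ k < d + 1, Js (k + 1) = (Js k).image (fun x => x + τ k) ∩ corridorsBar L w v (Bs k) := fun k _ => rfl
  have hrecI : ∀ k < d + 1, Is (k + 1) = (Is k).image fun x => x + τ k := fun k _ => rfl
  have hreca : ∀ k < d + 1, as (k + 1) = restrictCoef (shiftCoef (as k) (-τ k)) (corridorsBar L w v (Bs k)) := fun k _ => rfl
  have hrecC : ∀ k < d + 1, Cs (k + 1) = (Cs k).image fun x => x + τ k := fun k _ => rfl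
  have hrecz : ∀ k < d + 1, zs (k + 1) = fun y => zs k (y - τ k) := fun k _ => rfl
  have hrecb : ∀ k < d + 1, γ * bs (k + 1) = bs k := fun k _ => by
    show γ * (bs k / γ) = bs k
    rw [mul_div_assoc', mul_div_cancel_left₀ _ hγne]
  have hbzero : γ * bs 0 = b := by
    show γ * (b / γ) = b
    rw [mul_div_assoc', mul_div_cancel_left₀ _ hγne]
  have hB : ∀ k < d + 1, ((Js k).image fun x => x + τ k).image (boxIndex L) ⊆ Bs k := fun k _ => Finset.Subset.refl _
  have hbs : ∀ k, bs k = b / γ ^ (k + 1) := fun k => by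
    induction k with
    | zero => simp [bs]
    | succ k ih => show bs k / γ = _; rw [ih, div_div, ← pow_succ]
  have hble : ∀ k, b ≤ bs k := fun k => by
    rw [hbs, le_div_iff₀ (pow_pos hγ0 _)]
    exact mul_le_of_le_one_right hb0.le (hγpow1 _)
  have hbk : ∀ k ≤ d + 1, 1 ≤ bs k := fun k _ => hb1.trans (hble k)
  have hγbk : ∀ k < d + 1, 1 ≤ γ * bs k := fun k _ => by
    have e : γ * bs k = b / γ ^ k := by
      rw [hbs, pow_succ]; field_simp
    rw [e, le_div_iff₀ (pow_pos hγ0 _)]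
    exact (mul_le_of_le_one_right zero_le_one (hγpow1 _)).trans hb1
  have hsmk : ∀ k ≤ d, ((L : ℝ) ^ d) * Real.exp (-((bs k) ^ 2 / 4)) ≤ 1 / 6 := fun k _ => by
    refine le_trans (mul_le_mul_of_nonneg_left (Real.exp_le_exp.mpr ?_) (by positivity)) hsmall
    have h1 := hble k
    nlinarith [mul_le_mul h1 h1 hb0.le (hb0.le.trans h1)]
  -- the conditioning set stays far from the pavement along the chain
  have hfarK : ∀ k ≤ d + 1, ∀ x ∈ Cs k, ∀ y ∈ Js k, R ≤ cubeDist x y := by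
    intro k
    induction k with
    | zero => exact fun _ => hfar
    | succ k ih => exact fun hk => far_frame (ih (Nat.le_of_succ_le hk)) (τ k) Finset.inter_subset_left
  -- invariants along the chain
  have hinv := chain_invariants (L := L) (w := w) (v := v) (n := d + 1) ha'J ha'A hJI hrecJ hrecI hreca
  -- the separation of the shifted pavements
  have hsep : ∀ j j' : Fin (d + 1), j ≠ j' → ∀ (i : Fin d) (q : ℤ),
      (2 * (2 * w + v : ℕ) : ℤ) ≤ |(-(∑ i' ∈ Finset.range ((j : ℕ) + 1), τ i')) i - (-(∑ i' ∈ Finset.range ((j' : ℕ) + 1), τ i')) i - q * L| := by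
    intro j j' hjj' i q
    have h := sep_of_diagonalShifts (d := d) hfit j j' hjj' i q
    have e : ∀ n : ℕ, (-(∑ i' ∈ Finset.range (n + 1), τ i')) i = ((n : ℕ) + 1 : ℤ) * c := fun n => by
      rw [Pi.neg_apply, Finset.sum_apply]
      simp only [τ, Finset.sum_const, Finset.card_range, smul_neg, nsmul_eq_mul, neg_neg]
      push_cast; ring
    rw [e, e]; push_cast at h ⊢; exact h
  -- one lower step at every frame-`k` datum
  choose! u Err hP using fun k (hk : k < d + 1) =>
    exists_upper_step (s := s) (D := D) (κ := κ) (L := L) (w := w) (v := v) (J := (Js k).image fun x => x + τ k)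
      (I := (Is k).image fun x => x + τ k) (a := shiftCoef (as k) (-τ k)) hα hβ hvar hd hκ
      (coefSupportedIn_frame (hinv k hk.le).1 (τ k)) (Finset.image_subset_image (hinv k hk.le).2.2.1) hA0
      (abs_shiftCoef_neg_le (hinv k hk.le).2.1 (τ k)) hL hL2 hv hw (hbk k hk.le) hγ0.le hγ1 hγc (hsmk k (Nat.lt_succ_iff.mp hk)) hδ hδle hres t
      (far_frame (hfarK k hk.le) (τ k) (Finset.Subset.refl _)) hR
  -- the goal in chain form (`Is 0 ≡ I`, `Js 0 ≡ J`, `Cs 0 ≡ C`, `zs 0 ≡ z̄` by `Nat.rec` computation)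
  show Ineq46 d α β t D s κ S ρ₁ ρ₂ ρ₃ ρ₄ b (Is 0) (Js 0) (Cs 0) a (zs 0)
  refine ineq46_of_chain (Js := Js) (Is := Is) (Bs := Bs) (Cs := Cs) (as := as) (zs := zs) (bs := bs) (τ := τ) hα hβ hκ hL hw hv hγ1 a
    hbzero (ha'H κ) ha'J ha'A hJI hrecJ hrecI hreca hrecC hrecz hrecb (fun k hk => hbk k hk.le) hγbk hB u (fun k hk => (hP k hk).1) hsep
    _ (fun k hk => (hP k hk).2.1) ?_
  -- the ledger: every cardinality by `|I|`, every `Err(□)` by `ErrPB`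
  have hIs0 : Is 0 = I := rfl
  have hJs0 : Js 0 = J := rfl
  simp only [hIs0, hJs0] at hP ⊢
  simp only [hbs] at hP ⊢
  refine le_trans (Finset.sum_le_sum fun n hn => ?_) hledger
  have hn : n < d + 1 := Finset.mem_range.mp hn
  have hJn0 : ((Js n).card : ℝ) ≤ I.card := by exact_mod_cast (card_chain_le hrecJ n hn.le).trans (Finset.card_le_card hJI)
  have hJn : (((Js n).image fun x => x + τ n).card : ℝ) ≤ I.card := le_trans (by exact_mod_cast Finset.card_image_le) hJn0
  have hBn : ((Bs n).card : ℝ) ≤ I.card := le_trans (by exact_mod_cast card_boxes_le (L := L) (Js n) (τ n)) hJn0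
  have hCBn : ((corridorsBar L w v (Bs n)).card : ℝ) ≤ I.card * (L : ℝ) ^ d := by
    have h1 : ((corridorsBar L w v (Bs n)).card : ℝ) ≤ (Bs n).card * (L : ℝ) ^ d := by
      exact_mod_cast Literature.MathematicalPhysics.QuantumFieldTheory.Balaban1983to89.B1Eq324BenfattoSect5CollectErrors.card_corridorsBar_le
        (L := L) (w := w) (v := v) (Bs n)
    exact h1.trans (mul_le_mul_of_nonneg_right hBn (by positivity))
  have hS : 0 ≤ s1Const s D d κ := s1Const_nonneg s D d hκ.le
  have hbn0 : 0 ≤ b / γ ^ (n + 1) := by positivity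
  have hErr := sum_le_card_mul (B := Bs n) (n := (I.card : ℝ)) (fun m hm => ((hP n hn).2.2 m).trans_le
      (perBoxErr_le (s := s) (D := D) (w := w) (v := v) hα hβ hκ.le hA0 hL (Finset.image_subset_image (hinv n hn.le).2.2.1) hm hγ0.le hbn0 hres.le t))
      (errPB_nonneg (s := s) (D := D) (w := w) (v := v) hα hβ hκ.le hA0 hL hγ0.le hbn0 hres.le t) hBn
  have hC := cumb_le (s := s) (D := D) (L := L) (w := w) (v := v) (t := t) (α := α) (β := β) hA0 hδ.le hres.le hJn hBn hCBn
  refine add_le_add ?_ (add_le_add hErr hC)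
  have hc2 : 0 ≤ s1Const s D d κ * coefSup s D a J * (b / γ ^ (n + 1)) ^ D := by positivity
  have hc1 : 0 ≤ s1Const s D d κ * coefSup s D a J * (γ * (b / γ ^ (n + 1))) ^ D * Real.exp (-(κ / 4 * w)) := by positivity
  exact add_le_add (mul_le_mul_of_nonneg_left hJn0 hc1) (mul_le_mul_of_nonneg_left (add_le_add
    (mul_le_mul_of_nonneg_left hCBn (Real.exp_pos _).le)
    (mul_le_mul_of_nonneg_left (mul_le_mul_of_nonneg_right hBn (by positivity)) (Real.exp_pos _).le)) hc2)

end Assembly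

end Literature.MathematicalPhysics.QuantumFieldTheory.Balaban1983to89.B1Eq324BenfattoSect5UpperAssembly
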